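import Summits.Ventures.Crystal3D.Theorems.StickyWulffConstantPolycrystalWulffBoundPerSelf
import Literature.Analysis.Convexity.AnisotropicPerimeterSeparated

/-!
# `PolycrystalWulffBound` for textures whose grains lie at mutually positive distance

Route `StickyWulffConstant` of the venture `Summits/Ventures/Crystal3D`, crux `PolycrystalWulffBound`
(item `stmt-Ventures-19482`, continuum regime P), second prover lane (strategy «grain-count dichotomy +
quantitative Wulff stability», cf-p1 g16).  This file proves the crux's inequality, `let`-telescope
VERBATIM and for EVERY number `n` of grains and every choice of frames and wall data, under the extra
hypothesis that the grains are PAIRWISE AT POSITIVE DISTANCE: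

  `Tex n G A c m → (∀ f ≠ g, ∃ δ > 0, dist(G f, G g) ≥ δ) → 6·2^{1/3}(√2·Vol)^{2/3} ≤ En`.

This is the pure form of the CONCAVITY HALF of the dichotomy: every interface term
`ι_K(G f, G g) = (P_K(G f) + P_K(G g) − P_K(G f ∪ G g))/2` VANISHES for sets at positive distance
(`Literature.Analysis.Convexity.anisotropicPerimeter_union_eq_add_of_le_dist`: glue admissible
fields with a smooth cutoff — no structure theory), so `En = Σ_f Per_{W_{A f}}(G f)`; each grain obeys
the one-grain Wulff inequality `polycrystalWulffBound_singleGrain` (`6·2^{1/3}(√2|G f|)^{2/3} ≤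
Per_{W_{A f}}(G f)`); and `t ↦ t^{2/3}` is subadditive, `Σ_f (√2|G f|)^{2/3} ≥ (√2 Σ_f |G f|)^{2/3} =
(√2·Vol)^{2/3}` (disjoint grains).  It is also the first treatment of the crux's `Fin n` bookkeeping
(`En`, `Vol`) for general `n` (tree: `n = 1` `polycrystalWulffBound_n_one`, `n = 2` equal lattices
`polycrystalWulffBound_two_sameLattice`).

Contents: `convex_cruxWulffBody`, `zero_mem_cruxWulffBody` (with the tree's
`cruxWulffBody_subset_closedBall`, `W_A ⊆ B̄(0, √5)`), `convex_cruxDisc` / `zero_mem_cruxDisc` / `cruxDisc_subset_closedBall` (the wall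
bodies `{‖y‖ ≤ 1, ⟪y, m⟫ = 0}`), `cruxIota_eq_zero_of_le_dist` (the interface term of the crux vanishes
for grains at positive distance, every bounded convex body `K ∋ 0`), `rpow_two_thirds_sum_le`
(subadditivity of `t^{2/3}` over `Fin n`), and the theorem `polycrystalWulffBound_of_separated`.
WHAT THIS IS NOT: anything about grains in contact (walls of positive area) — the content of P; the
crux is not claimed.
-/

noncomputable section

namespace Summit.Ventures.Crystal3D.Theorems

open MeasureTheory Set Metric
open scoped RealInnerProductSpace InnerProductSpace ENNReal
open Literature.MathematicalPhysics.StatisticalMechanics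
open Literature.Analysis.Convexity (anisotropicPerimeter anisotropicPerimeter_union_eq_add_of_le_dist
  anisotropicPerimeter_le_mul_perimeter)

/-! ### The crux's constraint bodies: convex, contain `0`, bounded -/

/-- The crux's Wulff body `W_A = {y | ∀ ν, ⟪y, ν⟫ ≤ Φ(A⁻¹ν)}` is convex (an intersection of
half-spaces). -/
theorem convex_cruxWulffBody (A : EuclideanSpace ℝ (Fin 3) ≃ₗᵢ[ℝ] EuclideanSpace ℝ (Fin 3)) :
    Convex ℝ {y : EuclideanSpace ℝ (Fin 3) | ∀ ν : EuclideanSpace ℝ (Fin 3), ⟪y, ν⟫ ≤ Real.sqrt 2 / 4 *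
        ∑ᶠ w ∈ {w | w ∈ fccStacking 1 (Real.sqrt (2 / 3)) ∧ ‖w‖ = 1}, |⟪w, A.symm ν⟫|} := by
  intro y hy y' hy' a b ha hb hab ν
  have h1 := mul_le_mul_of_nonneg_left (hy ν) ha
  have h2 := mul_le_mul_of_nonneg_left (hy' ν) hb
  rw [inner_add_left, real_inner_smul_left, real_inner_smul_left]
  refine (add_le_add h1 h2).trans (le_of_eq ?_)
  rw [← add_mul, hab, one_mul]

/-- `0 ∈ W_A` (the tension `Φ` is nonnegative). -/
theorem zero_mem_cruxWulffBody (A : EuclideanSpace ℝ (Fin 3) ≃ₗᵢ[ℝ] EuclideanSpace ℝ (Fin 3)) :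
    (0 : EuclideanSpace ℝ (Fin 3)) ∈ {y : EuclideanSpace ℝ (Fin 3) | ∀ ν : EuclideanSpace ℝ (Fin 3),
      ⟪y, ν⟫ ≤ Real.sqrt 2 / 4 *
        ∑ᶠ w ∈ {w | w ∈ fccStacking 1 (Real.sqrt (2 / 3)) ∧ ‖w‖ = 1}, |⟪w, A.symm ν⟫|} := by
  intro ν
  rw [inner_zero_left]
  exact mul_nonneg (by positivity) (finsum_nonneg fun w => finsum_nonneg fun _ => abs_nonneg _)

/-- The crux's wall body `Dsc m = {y | ‖y‖ ≤ 1, ⟪y, m⟫ = 0}` (unit ball for `m = 0`, unit disc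
`⊥ m` otherwise) is convex. -/
theorem convex_cruxDisc (m : EuclideanSpace ℝ (Fin 3)) :
    Convex ℝ {y : EuclideanSpace ℝ (Fin 3) | ‖y‖ ≤ 1 ∧ ⟪y, m⟫ = 0} := by
  have h1 : Convex ℝ {y : EuclideanSpace ℝ (Fin 3) | ‖y‖ ≤ 1} := by
    have : {y : EuclideanSpace ℝ (Fin 3) | ‖y‖ ≤ 1} = closedBall 0 1 := by
      ext y; simp
    rw [this]; exact convex_closedBall 0 1
  have h2 : Convex ℝ {y : EuclideanSpace ℝ (Fin 3) | ⟪y, m⟫ = 0} := by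
    intro y hy y' hy' a b _ _ _
    simp only [mem_setOf_eq] at hy hy' ⊢
    rw [inner_add_left, real_inner_smul_left, real_inner_smul_left, hy, hy', mul_zero, mul_zero,
      add_zero]
  exact h1.inter h2

/-- `0 ∈ Dsc m`. -/
theorem zero_mem_cruxDisc (m : EuclideanSpace ℝ (Fin 3)) :
    (0 : EuclideanSpace ℝ (Fin 3)) ∈ {y : EuclideanSpace ℝ (Fin 3) | ‖y‖ ≤ 1 ∧ ⟪y, m⟫ = 0} := by
  simp

/-- `Dsc m ⊆ B̄(0, 1)`. -/
theorem cruxDisc_subset_closedBall (m : EuclideanSpace ℝ (Fin 3)) :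
    {y : EuclideanSpace ℝ (Fin 3) | ‖y‖ ≤ 1 ∧ ⟪y, m⟫ = 0} ⊆
      closedBall (0 : EuclideanSpace ℝ (Fin 3)) 1 := fun y hy => by
  rw [mem_closedBall, dist_zero_right]; exact hy.1

/-! ### The crux's interface term vanishes for grains at positive distance -/

/-- **`ι_K(S₁, S₂) = 0` for sets at positive distance.** For a convex body `K ∋ 0` inside a ball
`B̄(0, R)` and measurable sets `S₁, S₂` of finite perimeter with `dist x y ≥ δ > 0` for all `x ∈ S₁`,
`y ∈ S₂`, the crux's interface term `(Per K S₁ + Per K S₂ − Per K (S₁ ∪ S₂))/2`, in its `toReal`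
spelling, is `0` (additivity of the `K`-perimeter over separated sets + finiteness). -/
theorem cruxIota_eq_zero_of_le_dist {K : Set (EuclideanSpace ℝ (Fin 3))} (hK : Convex ℝ K)
    (h0 : (0 : EuclideanSpace ℝ (Fin 3)) ∈ K) {R : ℝ} (hR : 0 < R)
    (hKR : K ⊆ closedBall (0 : EuclideanSpace ℝ (Fin 3)) R)
    {S₁ S₂ : Set (EuclideanSpace ℝ (Fin 3))} (hS₁ : HasFinitePerimeter S₁)
    (hS₂ : HasFinitePerimeter S₂) {δ : ℝ} (hδ : 0 < δ) (hsep : ∀ x ∈ S₁, ∀ y ∈ S₂, δ ≤ dist x y) :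
    ((anisotropicPerimeter K S₁).toReal + (anisotropicPerimeter K S₂).toReal -
        (anisotropicPerimeter K (S₁ ∪ S₂)).toReal) / 2 = 0 := by
  have hfin : ∀ {S : Set (EuclideanSpace ℝ (Fin 3))}, perimeter S < ⊤ →
      anisotropicPerimeter K S ≠ ⊤ := fun hS =>
    ((anisotropicPerimeter_le_mul_perimeter hR hKR _).trans_lt
      (ENNReal.mul_lt_top ENNReal.ofReal_lt_top hS)).ne
  rw [anisotropicPerimeter_union_eq_add_of_le_dist hK h0 hS₁.1 hS₂.1 hδ hsep,
    ENNReal.toReal_add (hfin hS₁.2) (hfin hS₂.2)]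
  ring

/-! ### Subadditivity of `t ↦ t^{2/3}` over finite sums -/

/-- `(Σ_f a_f)^{2/3} ≤ Σ_f a_f^{2/3}` for `a_f ≥ 0` (concavity of `t^{2/3}` with value `0` at `0`). -/
theorem rpow_two_thirds_sum_le {ι : Type*} (s : Finset ι) {a : ι → ℝ} (ha : ∀ i, 0 ≤ a i) :
    (∑ i ∈ s, a i) ^ ((2 : ℝ) / 3) ≤ ∑ i ∈ s, a i ^ ((2 : ℝ) / 3) := by
  classical
  induction s using Finset.induction_on with
  | empty => simp [Real.zero_rpow (by norm_num : ((2 : ℝ) / 3) ≠ 0)]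
  | insert i s hi ih =>
    rw [Finset.sum_insert hi, Finset.sum_insert hi]
    exact (Real.rpow_add_le_add_rpow (ha i) (Finset.sum_nonneg fun j _ => ha j)
      (by norm_num) (by norm_num)).trans (by linarith)

/-! ### The theorem -/

/-- **`PolycrystalWulffBound` for textures with pairwise separated grains.** The crux's statement
(`let`-telescope verbatim), every `n`, every frames `A`, wall data `(c, m)`, under the extra hypothesis
that distinct grains lie at positive distance: `∀ f ≠ g, ∃ δ > 0, ∀ x ∈ G f, ∀ y ∈ G g, δ ≤ dist x y`.
Proof: all interface terms `ι` vanish (`cruxIota_eq_zero_of_le_dist` for the Wulff bodies `W_{A f}`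
and the wall bodies `Dsc (m f g)`), so `En = Σ_f Per_{W_{A f}}(G f)`; the one-grain Wulff inequality
`polycrystalWulffBound_singleGrain` bounds each term by `6·2^{1/3}(√2|G f|)^{2/3}`; the grains are
disjoint, so `Vol = Σ_f |G f|`, and `t ↦ t^{2/3}` is subadditive. Unconditional. -/
theorem polycrystalWulffBound_of_separated :
    let Λ : Set (EuclideanSpace ℝ (Fin 3)) := Literature.MathematicalPhysics.StatisticalMechanics.fccStacking 1 (Real.sqrt (2 / 3));
    let Brl : (ℤ → ℤ) → Set (EuclideanSpace ℝ (Fin 3)) := Literature.MathematicalPhysics.StatisticalMechanics.barlowStacking 1 (Real.sqrt (2 / 3));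
    let Ax : EuclideanSpace ℝ (Fin 3) → (EuclideanSpace ℝ (Fin 3) ≃ₗᵢ[ℝ] EuclideanSpace ℝ (Fin 3)) → (EuclideanSpace ℝ (Fin 3) ≃ₗᵢ[ℝ] EuclideanSpace ℝ (Fin 3)) → Prop := fun m A B => ∃ (L : EuclideanSpace ℝ (Fin 3) ≃ₗᵢ[ℝ] EuclideanSpace ℝ (Fin 3)) (s₁ s₂ : EuclideanSpace ℝ (Fin 3)) (σ σ' : ℤ → ℤ), Literature.MathematicalPhysics.StatisticalMechanics.IsHaggSeq σ ∧ Literature.MathematicalPhysics.StatisticalMechanics.IsHaggSeq σ' ∧ L (EuclideanSpace.single (2 : Fin 3) (1 : ℝ)) = m ∧ A '' Λ ⊆ (fun q => L q + s₁) '' Brl σ ∧ B '' Λ ⊆ (fun q => L q + s₂) '' Brl σ';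
    let CoAx : (EuclideanSpace ℝ (Fin 3) ≃ₗᵢ[ℝ] EuclideanSpace ℝ (Fin 3)) → (EuclideanSpace ℝ (Fin 3) ≃ₗᵢ[ℝ] EuclideanSpace ℝ (Fin 3)) → Prop := fun A B => ∃ m, Ax m A B;
    let Φ : EuclideanSpace ℝ (Fin 3) → ℝ := fun ν => Real.sqrt 2 / 4 * ∑ᶠ w ∈ {w ∈ Λ | ‖w‖ = 1}, |⟪w, ν⟫_ℝ|;
    let Per : Set (EuclideanSpace ℝ (Fin 3)) → Set (EuclideanSpace ℝ (Fin 3)) → ℝ := fun K S => (⨆ (ξ : EuclideanSpace ℝ (Fin 3) → EuclideanSpace ℝ (Fin 3)) (_ : ContDiff ℝ 1 ξ ∧ HasCompactSupport ξ ∧ ∀ z, ξ z ∈ K), ENNReal.ofReal (∫ z in S, Literature.MathematicalPhysics.StatisticalMechanics.fieldDivergence ξ z)).toReal;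
    let ι : Set (EuclideanSpace ℝ (Fin 3)) → Set (EuclideanSpace ℝ (Fin 3)) → Set (EuclideanSpace ℝ (Fin 3)) → ℝ := fun K S₁ S₂ => (Per K S₁ + Per K S₂ - Per K (S₁ ∪ S₂)) / 2;
    let W : (EuclideanSpace ℝ (Fin 3) ≃ₗᵢ[ℝ] EuclideanSpace ℝ (Fin 3)) → Set (EuclideanSpace ℝ (Fin 3)) := fun A => {y | ∀ ν : EuclideanSpace ℝ (Fin 3), ⟪y, ν⟫_ℝ ≤ Φ (A.symm ν)};
    let Dsc : EuclideanSpace ℝ (Fin 3) → Set (EuclideanSpace ℝ (Fin 3)) := fun m => {y | ‖y‖ ≤ 1 ∧ ⟪y, m⟫_ℝ = 0};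
    let Tex : (n : ℕ) → (Fin n → Set (EuclideanSpace ℝ (Fin 3))) → (Fin n → (EuclideanSpace ℝ (Fin 3) ≃ₗᵢ[ℝ] EuclideanSpace ℝ (Fin 3))) → (Fin n → Fin n → ℝ) → (Fin n → Fin n → EuclideanSpace ℝ (Fin 3)) → Prop := fun n G A c m => (∀ f : Fin n, Literature.MathematicalPhysics.StatisticalMechanics.HasFinitePerimeter (G f) ∧ volume (G f) < ⊤) ∧ (∀ f g, f ≠ g → Disjoint (G f) (G g)) ∧ (∀ f g, f ≠ g → 0 ≤ c f g) ∧ (∀ f g, f ≠ g → ¬ CoAx (A f) (A g) → m f g = 0 ∧ 1 ≤ c f g) ∧ (∀ f g, f ≠ g → CoAx (A f) (A g) → A f '' Λ ≠ A g '' Λ → Ax (m f g) (A f) (A g) ∧ 1 / 2 ≤ c f g);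
    let En : (n : ℕ) → (Fin n → Set (EuclideanSpace ℝ (Fin 3))) → (Fin n → (EuclideanSpace ℝ (Fin 3) ≃ₗᵢ[ℝ] EuclideanSpace ℝ (Fin 3))) → (Fin n → Fin n → ℝ) → (Fin n → Fin n → EuclideanSpace ℝ (Fin 3)) → ℝ := fun n G A c m => ∑ f : Fin n, Per (W (A f)) (G f) - ∑ f, ∑ g, (if f = g then 0 else ι (W (A f)) (G f) (G g)) + ∑ f, ∑ g, (if f = g then 0 else c f g / 2 * ι (Dsc (m f g)) (G f) (G g));
    let Vol : (n : ℕ) → (Fin n → Set (EuclideanSpace ℝ (Fin 3))) → ℝ := fun n G => (volume (⋃ f : Fin n, G f)).toReal;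
    ∀ (n : ℕ) (G : Fin n → Set (EuclideanSpace ℝ (Fin 3))) (A : Fin n → (EuclideanSpace ℝ (Fin 3) ≃ₗᵢ[ℝ] EuclideanSpace ℝ (Fin 3))) (c : Fin n → Fin n → ℝ) (m : Fin n → Fin n → EuclideanSpace ℝ (Fin 3)), Tex n G A c m →
      (∀ f g : Fin n, f ≠ g → ∃ δ : ℝ, 0 < δ ∧ ∀ x ∈ G f, ∀ y ∈ G g, δ ≤ dist x y) →
      6 * (2 : ℝ) ^ ((1 : ℝ) / 3) * (Real.sqrt 2 * Vol n G) ^ ((2 : ℝ) / 3) ≤ En n G A c m := by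
  intro Λ Brl Ax CoAx Φ Per ι W Dsc Tex En Vol n G A c m hTex hsep
  obtain ⟨hfin, hdisj, -, -, -⟩ := hTex
  -- every interface term vanishes
  have hιW : ∀ f g : Fin n, f ≠ g → ι (W (A f)) (G f) (G g) = 0 := by
    intro f g hfg
    obtain ⟨δ, hδ, hδsep⟩ := hsep f g hfg
    exact cruxIota_eq_zero_of_le_dist (convex_cruxWulffBody (A f)) (zero_mem_cruxWulffBody (A f))
      (Real.sqrt_pos.2 (by norm_num)) (cruxWulffBody_subset_closedBall (A f)) (hfin f).1 (hfin g).1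
      hδ hδsep
  have hιD : ∀ f g : Fin n, f ≠ g → ι (Dsc (m f g)) (G f) (G g) = 0 := by
    intro f g hfg
    obtain ⟨δ, hδ, hδsep⟩ := hsep f g hfg
    exact cruxIota_eq_zero_of_le_dist (convex_cruxDisc (m f g)) (zero_mem_cruxDisc (m f g))
      one_pos (cruxDisc_subset_closedBall (m f g)) (hfin f).1 (hfin g).1 hδ hδsep
  -- the energy is the sum of the grains' full anisotropic perimeters
  have hEn : En n G A c m = ∑ f : Fin n, Per (W (A f)) (G f) := by
    show (∑ f : Fin n, Per (W (A f)) (G f) - ∑ f : Fin n, ∑ g : Fin n,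
        (if f = g then 0 else ι (W (A f)) (G f) (G g)) +
        ∑ f : Fin n, ∑ g : Fin n, (if f = g then 0 else c f g / 2 * ι (Dsc (m f g)) (G f) (G g))) =
      ∑ f : Fin n, Per (W (A f)) (G f)
    have h1 : ∑ f : Fin n, ∑ g : Fin n, (if f = g then 0 else ι (W (A f)) (G f) (G g)) = 0 := by
      refine Finset.sum_eq_zero fun f _ => Finset.sum_eq_zero fun g _ => ?_
      split_ifs with hfg
      · rfl
      · exact hιW f g hfg
    have h2 : ∑ f : Fin n, ∑ g : Fin n,
        (if f = g then 0 else c f g / 2 * ι (Dsc (m f g)) (G f) (G g)) = 0 := by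
      refine Finset.sum_eq_zero fun f _ => Finset.sum_eq_zero fun g _ => ?_
      split_ifs with hfg
      · rfl
      · rw [hιD f g hfg, mul_zero]
    rw [h1, h2]; ring
  -- the volume is the sum of the grains' volumes
  have hVol : Vol n G = ∑ f : Fin n, (volume (G f)).toReal := by
    show (volume (⋃ f : Fin n, G f)).toReal = ∑ f : Fin n, (volume (G f)).toReal
    rw [measure_iUnion (fun f g hfg => hdisj f g hfg) (fun f => (hfin f).1.1), tsum_fintype,
      ENNReal.toReal_sum (fun f _ => (hfin f).2.ne)]
  -- one-grain Wulff inequality, grain by grain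
  have hgrain : ∀ f : Fin n, 6 * (2 : ℝ) ^ ((1 : ℝ) / 3) *
      (Real.sqrt 2 * (volume (G f)).toReal) ^ ((2 : ℝ) / 3) ≤ Per (W (A f)) (G f) := fun f =>
    polycrystalWulffBound_singleGrain (A f) (hfin f).1 (hfin f).2
  -- concavity of `t ↦ t^{2/3}`
  have hconc : (Real.sqrt 2 * Vol n G) ^ ((2 : ℝ) / 3) ≤
      ∑ f : Fin n, (Real.sqrt 2 * (volume (G f)).toReal) ^ ((2 : ℝ) / 3) := by
    rw [hVol, Finset.mul_sum]
    exact rpow_two_thirds_sum_le _ fun f => by positivity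
  rw [hEn]
  calc 6 * (2 : ℝ) ^ ((1 : ℝ) / 3) * (Real.sqrt 2 * Vol n G) ^ ((2 : ℝ) / 3)
      ≤ 6 * (2 : ℝ) ^ ((1 : ℝ) / 3) *
          ∑ f : Fin n, (Real.sqrt 2 * (volume (G f)).toReal) ^ ((2 : ℝ) / 3) := by
        gcongr
    _ = ∑ f : Fin n, 6 * (2 : ℝ) ^ ((1 : ℝ) / 3) *
          (Real.sqrt 2 * (volume (G f)).toReal) ^ ((2 : ℝ) / 3) := by rw [Finset.mul_sum]
    _ ≤ ∑ f : Fin n, Per (W (A f)) (G f) := Finset.sum_le_sum fun f _ => hgrain f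

end Summit.Ventures.Crystal3D.Theorems

end
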